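import Summits.BirchSwinnertonDyer.BirchSwinnertonDyer.Theorems.PrintX11aUpperNonSurjFiveCartanDescent
import Summits.BirchSwinnertonDyer.BirchSwinnertonDyer.Theses.PrintX11a
import HarnessLib

/-!
# Route `PrintX11a`, crux U5 = `Theses.PrintX11a.UpperNonSurjFive` (item stmt-BirchSwinnertonDyer-20614), line of record
# «gl1cartan5»: the proved sector RE-CUT ALONG ARITHMETIC INVARIANTS (datum-free) — U5 holds wherever `Ш(E)[p] = 0` and no
# prime is split multiplicative; the Cartan descent D is the certificate engine for `Ш(E)[p] = 0` on the main locus; the open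
# part of U5 is `Ш(E)[p] ≠ 0` (exponent term) or a split multiplicative prime (Tamagawa term) — with exactness

Cell `bsd-print-x11a`, LEAD `cruxlead-stmt-BirchSwinnertonDyer-20614` g3.  State inherited (skeleton rev 7, files p659482 / p661519): the line
proves the SECTOR «main locus ∧ some Cartan descent datum `𝒟` has `S(𝒟) = 0` ⇒ `MissingUpperBoundAt W p`» modulo three named print
facts (Gross–Zagier–Kolyvagin, modularity, Mazur's Manin-constant theorem) and leaves two residuals stated through the line's own
gadgets (`MainLocus`, `CartanDatum`, `SelmerTrivial`): R₁ = «off the main locus», R₂ = «main locus, every datum GL₁-obstructed».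

WHAT THIS FILE ADDS (theorems only; no definition, no named fact minted, no `sorry`):

* §1 `GL1Cartan.upperNonSurjFive_on_noPTorsion_of_noSplitMult` — the sector of U5 that the tree's doors ALREADY give, stated
  without any datum: on X11a with `p ≥ 5`, NO split multiplicative prime and `Ш(E)[p] = 0`, `MissingUpperBoundAt W p` holds
  (conditionally on the same three prints: `#Ш_an ∈ ℤ_(p)` by the landed bridge `shaAnIntegral_of_mazur`, then the door
  `ClassX11a.missingUpperBoundAt_of_noPTorsion`).  No descent is used.
* §2 `GL1Cartan.noPTorsion_of_selmerTrivial_of_mainLocus` — the line's lever D (`stub_cartanDescent`, landed) READ AS A CERTIFICATE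
  ENGINE for the hypothesis of §1: on the main locus a datum with `S(𝒟) = 0` gives `Ш(E)[p] = 0` (via `#Sel_p(E/ℚ) ≤ 1` and
  `rank E(ℚ) = 0` from GZK); and `GL1Cartan.noSplitMult_of_mainLocus` (the main locus has no split multiplicative prime).  Hence the
  registered sector is the main-locus slice of §1 (`sector_of_noPTorsionSector`).
* §3 the crux BY NAME from §1's sector and two ARITHMETIC residual statements, fact-free glue by cases
  (`upperNonSurjFive_of_noPTorsionSector_of_residuals`) and with the sector inlined (`upperNonSurjFive_of_facts_of_arithResiduals`):
    R′  = «X11a, `¬ Surj`, `p ≥ 5`, no split multiplicative prime, `Ш(E)[p] ≠ 0` ⇒ `MissingUpperBoundAt W p`» (the EXPONENT term of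
          the Euler-system inequality: `#Ш(E)[p^∞] ≤ |#Ш_an|_p⁻¹` where BSD predicts `Ш[p] ≠ 0`; census: the 15 main-locus pairs of
          `Cruxes/UpperNonSurjFive/R2-CENSUS-cruxlead-g2.md`, three certified),
    R₁′ = «X11a, `¬ Surj`, `p ≥ 5`, SOME split multiplicative prime ⇒ `MissingUpperBoundAt W p`» (the TAMAGAWA term: on X11a every
          multiplicative `ℓ ≠ p` has `p ∣ v_ℓ(Δ)` (`¬ Ram`) and `p ∣ v_p(Δ)` at a non-surjective `p`, so a split multiplicative prime has
          `p ∣ c`, and `ord_p #Ш_an ≥ 0` already asks `ord_p (L(E,1)/Ω) ≥ ord_p ∏ c_ℓ`; at `ℓ = p` compounded by the exceptional zero).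
  Both are U5 VERBATIM on sub-loci (open; same wall as every line on this crux: an integral Euler-system bound at mod-`p` image
  `N(C_s)`/`5S4`), kept as unfolded hypotheses — not tree declarations (review of p655372).
* §4 exactness `upperNonSurjFive_iff_noPTorsionSector_and_arithResiduals : U5 ↔ SECTOR′ ∧ R′ ∧ R₁′` (fact-free), and the comparison
  with the registered cut: `arithResiduals_of_residuals` (R₁ ∧ R₂ ⇒ R′ ∧ R₁′, modulo GZK through §2) and
  `residuals_of_arithResiduals` (R′ ∧ R₁′ ⇒ R₁ ∧ R₂, modulo the three prints through §1) — the two splits are equivalent modulo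
  the prints; the new one has DATUM-FREE children and a strictly larger proved sector (it also contains the off-locus pairs — image
  `5S4`, real Cartan field, Cartan-inert multiplicative `ℓ` — with `Ш(E)[p] = 0` and no split multiplicative prime).

HONEST FRAMING.  Item 20614 is NOT closed by this file (U5 is proved only from hypotheses that include the two open residuals; the gate
records `proof.conditional`, credits nothing).  §1 is near-tautological bookkeeping (no `p`-torsion in `Ш` and a `p`-integral `#Ш_an`
give the inequality with left side `0`); its value is to state the line's proved sector by arithmetic invariants so that the planner's
children and the disprover's targets are intrinsic.  The leaf `ClassX11a` is not closed; no statement of the summit is proved; BSD is not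
proved by any of this and nothing here bounds a non-trivial `Ш`.  «beyond-print theorem: NO».

References: [Miller2011LMS] Def. 1.1 (shape of `MissingUpperBoundAt`); [SilvermanAEC2009] Thm. X.4.2 (a) (`#Sel_p ≤ p^rank ⇒ Ш[p] = 0`);
[MazurRubin2004] Def. 2.1.1; [Wuthrich2014] Thm. 1, Cor. 7; [Mazur1978] Cor. 4.1; tree `Theorems/PrintX11aUpperNonSurjFiveCartanDescent.lean`
(p659482), `Theorems/PrintX11aUpperNonSurjFiveOfSectorResiduals.lean` (p661519), `Cruxes/UpperNonSurjFive/Lines/gl1cartan5.lean` (rev 7).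
-/

-- justified: the file namespace `Summit.BirchSwinnertonDyer.BirchSwinnertonDyer.Theorems.GL1Cartan` repeats the sub-problem segment by the D-0017 layout
set_option linter.dupNamespace false
set_option autoImplicit false

noncomputable section

open scoped Classical NumberField

open WeierstrassCurve
  Literature.NumberTheory.EllipticCurves
  Literature.NumberTheory.EllipticCurves.Rank1Residual
  Literature.NumberTheory.EllipticCurves.Rank1Residual.Typed
  Literature.NumberTheory.SerreUniformity
  Summit.BirchSwinnertonDyer.Rank1Residual
  Summit.BirchSwinnertonDyer.BirchSwinnertonDyer.Theses

namespace Summit.BirchSwinnertonDyer.BirchSwinnertonDyer.Theorems.GL1Cartan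

/-! ## §1 The datum-free sector: no split multiplicative prime and `Ш(E)[p] = 0` -/

/-- **The no-`p`-torsion sector of U5 (CONDITIONAL on three named print facts; no descent used).**  For minimal `E/ℚ` in class X11a at
`p ≥ 5` with NO split multiplicative prime and `Ш(E/ℚ)[p] = 0`, the Euler half `MissingUpperBoundAt W p` holds: `#Ш_an ∈ ℚ` is
`p`-integral by the landed bridge `shaAnIntegral_of_mazur` (modularity `hnf`, Mazur's Manin-constant theorem `hMz`, GZK `hGZK`; no split
multiplicative prime ⇒ `p ∤ ∏ c_ℓ`), and `Ш` finite (GZK on X11a) with no `p`-torsion has `ord_p #Ш = 0`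
(`ClassX11a.missingUpperBoundAt_of_noPTorsion`).  The hypothesis `¬ Surj W p` is carried for the shape of U5 and not used.
[cite: Wuthrich2014, Thm. 1 and Cor. 7] [cite: Mazur1978, Cor. 4.1] [cite: Miller2011LMS, Def. 1.1 (arXiv:1010.2431 p. 3)] -/
theorem upperNonSurjFive_on_noPTorsion_of_noSplitMult
    (hGZK : rank_eq_analyticRank_of_analyticRank_le_one)
    (hnf : Literature.NumberTheory.EllipticCurves.ModularForms.exists_isNewformOf)
    (hMz : Literature.NumberTheory.EllipticCurves.ModularForms.mazur_not_dvd_maninConstant_of_odd) :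
    ∀ (W : WeierstrassCurve ℚ) [W.IsElliptic] [W.IsGloballyMinimal] (p : ℕ) [Fact p.Prime],
      ClassX11a W p → ¬ Surj W p → 5 ≤ p → (∀ (ℓ : ℕ) [Fact ℓ.Prime], ¬ W.HasSplitMultiplicativeReductionAtPrime ℓ) →
      (∀ x : W.sha, (p : ℤ) • x = 0 → x = 0) → MissingUpperBoundAt W p := by
  intro W _ _ p _ hX _ hp5 hnsm hSha
  obtain ⟨q, hq, hv⟩ := shaAnIntegral_of_mazur hnf hMz hGZK W p hX hp5 hnsm
  exact hX.missingUpperBoundAt_of_noPTorsion hGZK hq hv hSha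

/-! ## §2 The line's lever D as the certificate engine of §1's hypothesis on the main locus -/

/-- **On the main locus no prime is split multiplicative** (at `p` by the locus, at `ℓ ≠ p` by the datum's `splitAway`); restated in the
binder shape of §1. [cite: Serre1972, §2.8] -/
theorem noSplitMult_of_mainLocus {W : WeierstrassCurve ℚ} [W.IsElliptic] {p : ℕ} [Fact p.Prime] (hL : MainLocus W p) :
    ∀ (ℓ : ℕ) [Fact ℓ.Prime], ¬ W.HasSplitMultiplicativeReductionAtPrime ℓ :=
  fun ℓ _ => not_hasSplitMultiplicativeReductionAtPrime_of_mainLocus hL ℓ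

/-- **D as a certificate: `S(𝒟) = 0` on the main locus ⇒ `Ш(E/ℚ)[p] = 0`** (CONDITIONAL on GZK).  The landed Cartan descent
`stub_cartanDescent` gives `#Sel_p(E/ℚ) ≤ 1`; X11a has `rank E(ℚ) = 0` (`r_an = 0` + Gross–Zagier–Kolyvagin), so `#Sel_p ≤ p^rank` and
`Ш(E/ℚ)[p] = 0` (`noPTorsion_of_card_selmerGroup_le_pow_rank`, Silverman X.4.2).  This is how the line's per-pair class-group certificate
(an octic ray class group computation deciding `S(𝒟) = 0`) feeds the datum-free sector of §1.
[cite: MazurRubin2004, Def. 2.1.1] [cite: SilvermanAEC2009, Thm. X.4.2 (a)] -/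
theorem noPTorsion_of_selmerTrivial_of_mainLocus (hGZK : rank_eq_analyticRank_of_analyticRank_le_one)
    {W : WeierstrassCurve ℚ} [W.IsElliptic] [W.IsGloballyMinimal] {p : ℕ} [Fact p.Prime]
    (hX : ClassX11a W p) (hp5 : 5 ≤ p) (hL : MainLocus W p) (𝒟 : CartanDatum W p) (h𝒟 : 𝒟.SelmerTrivial) :
    ∀ x : W.sha, (p : ℤ) • x = 0 → x = 0 :=
  noPTorsion_of_card_selmerGroup_le_pow_rank W p
    (by
      rw [hX.mordellWeilRank_eq_zero hGZK, pow_zero]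
      exact stub_cartanDescent W p hX hp5 hL.1 hL.2.1 hL.2.2.1 𝒟 h𝒟)

/-- **The registered sector (rev 7) is the main-locus slice of the datum-free sector**: given §1's statement as a hypothesis and GZK,
«main locus ∧ some datum with `S(𝒟) = 0` ⇒ `MissingUpperBoundAt W p`» follows (fact-free apart from GZK, which §2 needs for `rank = 0`).
[cite: MazurRubin2004, Def. 2.1.1] [cite: Miller2011LMS, Def. 1.1] -/
theorem sector_of_noPTorsionSector (hGZK : rank_eq_analyticRank_of_analyticRank_le_one)
    (hS' : ∀ (W : WeierstrassCurve ℚ) [W.IsElliptic] [W.IsGloballyMinimal] (p : ℕ) [Fact p.Prime],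
      ClassX11a W p → ¬ Surj W p → 5 ≤ p → (∀ (ℓ : ℕ) [Fact ℓ.Prime], ¬ W.HasSplitMultiplicativeReductionAtPrime ℓ) →
      (∀ x : W.sha, (p : ℤ) • x = 0 → x = 0) → MissingUpperBoundAt W p) :
    ∀ (W : WeierstrassCurve ℚ) [W.IsElliptic] [W.IsGloballyMinimal] (p : ℕ) [Fact p.Prime],
      ClassX11a W p → ¬ Surj W p → 5 ≤ p → MainLocus W p → (∃ 𝒟 : CartanDatum W p, 𝒟.SelmerTrivial) →
      MissingUpperBoundAt W p := by
  intro W _ _ p _ hX hns hp5 hL h𝒟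
  obtain ⟨𝒟, h𝒟⟩ := h𝒟
  exact hS' W p hX hns hp5 (noSplitMult_of_mainLocus hL) (noPTorsion_of_selmerTrivial_of_mainLocus hGZK hX hp5 hL 𝒟 h𝒟)

/-! ## §3 The crux BY NAME from the datum-free sector and the two arithmetic residuals (glue, both shapes) -/

/-- **Glue, shape A′ (fact-free): SECTOR′ → R′ → R₁′ → U5.**  If U5's conclusion holds (i) wherever no prime is split multiplicative and
`Ш(E)[p] = 0` (SECTOR′, served by `upperNonSurjFive_on_noPTorsion_of_noSplitMult` modulo three prints), (ii) wherever no prime is split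
multiplicative and `Ш(E)[p] ≠ 0` (R′, the exponent term) and (iii) wherever some prime is split multiplicative (R₁′, the Tamagawa term),
then U5 = `Theses.PrintX11a.UpperNonSurjFive` holds: a case split, nothing else.  None of the three hypotheses is discharged here.
[cite: Miller2011LMS, Def. 1.1 (shape of the halves)] -/
theorem upperNonSurjFive_of_noPTorsionSector_of_residuals
    (hS' : ∀ (W : WeierstrassCurve ℚ) [W.IsElliptic] [W.IsGloballyMinimal] (p : ℕ) [Fact p.Prime],
      ClassX11a W p → ¬ Surj W p → 5 ≤ p → (∀ (ℓ : ℕ) [Fact ℓ.Prime], ¬ W.HasSplitMultiplicativeReductionAtPrime ℓ) →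
      (∀ x : W.sha, (p : ℤ) • x = 0 → x = 0) → MissingUpperBoundAt W p)
    (hR' : ∀ (W : WeierstrassCurve ℚ) [W.IsElliptic] [W.IsGloballyMinimal] (p : ℕ) [Fact p.Prime],
      ClassX11a W p → ¬ Surj W p → 5 ≤ p → (∀ (ℓ : ℕ) [Fact ℓ.Prime], ¬ W.HasSplitMultiplicativeReductionAtPrime ℓ) →
      (∃ x : W.sha, (p : ℤ) • x = 0 ∧ x ≠ 0) → MissingUpperBoundAt W p)
    (hR₁' : ∀ (W : WeierstrassCurve ℚ) [W.IsElliptic] [W.IsGloballyMinimal] (p : ℕ) [Fact p.Prime],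
      ClassX11a W p → ¬ Surj W p → 5 ≤ p →
      (∃ (ℓ : ℕ) (_ : Fact ℓ.Prime), W.HasSplitMultiplicativeReductionAtPrime ℓ) → MissingUpperBoundAt W p) :
    PrintX11a.UpperNonSurjFive := by
  intro W _ _ p _ hX hns hp5
  by_cases hsm : ∃ (ℓ : ℕ) (_ : Fact ℓ.Prime), W.HasSplitMultiplicativeReductionAtPrime ℓ
  · exact hR₁' W p hX hns hp5 hsm
  · have hnsm : ∀ (ℓ : ℕ) [Fact ℓ.Prime], ¬ W.HasSplitMultiplicativeReductionAtPrime ℓ :=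
      fun ℓ hℓ h => hsm ⟨ℓ, hℓ, h⟩
    by_cases hSha : ∀ x : W.sha, (p : ℤ) • x = 0 → x = 0
    · exact hS' W p hX hns hp5 hnsm hSha
    · push Not at hSha
      exact hR' W p hX hns hp5 hnsm hSha

/-- **Glue, shape B′ (sector inlined): GZK → modularity → Mazur → R′ → R₁′ → U5.**  The sector hypothesis of shape A′ is discharged by
§1 (`upperNonSurjFive_on_noPTorsion_of_noSplitMult`), conditional on the three named print facts
`rank_eq_analyticRank_of_analyticRank_le_one` (route item `RankEqAnalyticRankLeOne`), `exists_isNewformOf` (route item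
`NewformOfEllipticCurve`) and `mazur_not_dvd_maninConstant_of_odd`; so U5 holds granted those three prints and the two arithmetic
residuals.  CONDITIONAL (credits nothing): R′ and R₁′ are open. [cite: Mazur1978, Cor. 4.1] [cite: Wuthrich2014, Thm. 1 and Cor. 7] -/
theorem upperNonSurjFive_of_facts_of_arithResiduals
    (hGZK : rank_eq_analyticRank_of_analyticRank_le_one)
    (hnf : Literature.NumberTheory.EllipticCurves.ModularForms.exists_isNewformOf)
    (hMz : Literature.NumberTheory.EllipticCurves.ModularForms.mazur_not_dvd_maninConstant_of_odd)
    (hR' : ∀ (W : WeierstrassCurve ℚ) [W.IsElliptic] [W.IsGloballyMinimal] (p : ℕ) [Fact p.Prime],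
      ClassX11a W p → ¬ Surj W p → 5 ≤ p → (∀ (ℓ : ℕ) [Fact ℓ.Prime], ¬ W.HasSplitMultiplicativeReductionAtPrime ℓ) →
      (∃ x : W.sha, (p : ℤ) • x = 0 ∧ x ≠ 0) → MissingUpperBoundAt W p)
    (hR₁' : ∀ (W : WeierstrassCurve ℚ) [W.IsElliptic] [W.IsGloballyMinimal] (p : ℕ) [Fact p.Prime],
      ClassX11a W p → ¬ Surj W p → 5 ≤ p →
      (∃ (ℓ : ℕ) (_ : Fact ℓ.Prime), W.HasSplitMultiplicativeReductionAtPrime ℓ) → MissingUpperBoundAt W p) :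
    PrintX11a.UpperNonSurjFive :=
  upperNonSurjFive_of_noPTorsionSector_of_residuals (upperNonSurjFive_on_noPTorsion_of_noSplitMult hGZK hnf hMz) hR' hR₁'

/-! ## §4 Exactness of the arithmetic split, and comparison with the registered split -/

/-- U5 gives the datum-free sector statement back (restriction). [cite: Miller2011LMS, Def. 1.1] -/
theorem noPTorsionSector_of_upperNonSurjFive (h : PrintX11a.UpperNonSurjFive) :
    ∀ (W : WeierstrassCurve ℚ) [W.IsElliptic] [W.IsGloballyMinimal] (p : ℕ) [Fact p.Prime],
      ClassX11a W p → ¬ Surj W p → 5 ≤ p → (∀ (ℓ : ℕ) [Fact ℓ.Prime], ¬ W.HasSplitMultiplicativeReductionAtPrime ℓ) →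
      (∀ x : W.sha, (p : ℤ) • x = 0 → x = 0) → MissingUpperBoundAt W p :=
  fun W _ _ p _ hX hns hp5 _ _ => h W p hX hns hp5

/-- U5 gives the exponent residual R′ back (restriction). [cite: Miller2011LMS, Def. 1.1] -/
theorem pTorsionResidual_of_upperNonSurjFive (h : PrintX11a.UpperNonSurjFive) :
    ∀ (W : WeierstrassCurve ℚ) [W.IsElliptic] [W.IsGloballyMinimal] (p : ℕ) [Fact p.Prime],
      ClassX11a W p → ¬ Surj W p → 5 ≤ p → (∀ (ℓ : ℕ) [Fact ℓ.Prime], ¬ W.HasSplitMultiplicativeReductionAtPrime ℓ) →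
      (∃ x : W.sha, (p : ℤ) • x = 0 ∧ x ≠ 0) → MissingUpperBoundAt W p :=
  fun W _ _ p _ hX hns hp5 _ _ => h W p hX hns hp5

/-- U5 gives the Tamagawa residual R₁′ back (restriction). [cite: Miller2011LMS, Def. 1.1] -/
theorem splitMultResidual_of_upperNonSurjFive (h : PrintX11a.UpperNonSurjFive) :
    ∀ (W : WeierstrassCurve ℚ) [W.IsElliptic] [W.IsGloballyMinimal] (p : ℕ) [Fact p.Prime],
      ClassX11a W p → ¬ Surj W p → 5 ≤ p →
      (∃ (ℓ : ℕ) (_ : Fact ℓ.Prime), W.HasSplitMultiplicativeReductionAtPrime ℓ) → MissingUpperBoundAt W p :=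
  fun W _ _ p _ hX hns hp5 _ => h W p hX hns hp5

/-- **Exactness of the arithmetic split (fact-free): U5 ↔ SECTOR′ ∧ R′ ∧ R₁′.**  The crux `Theses.PrintX11a.UpperNonSurjFive` is
EQUIVALENT to the conjunction of the datum-free sector statement and the two arithmetic residual statements — a glued split of item
20614 into these three children (or, shape B′, into three print binders + R′ + R₁′) is lossless. [cite: Miller2011LMS, Def. 1.1] -/
theorem upperNonSurjFive_iff_noPTorsionSector_and_arithResiduals :
    PrintX11a.UpperNonSurjFive ↔
      ((∀ (W : WeierstrassCurve ℚ) [W.IsElliptic] [W.IsGloballyMinimal] (p : ℕ) [Fact p.Prime],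
          ClassX11a W p → ¬ Surj W p → 5 ≤ p → (∀ (ℓ : ℕ) [Fact ℓ.Prime], ¬ W.HasSplitMultiplicativeReductionAtPrime ℓ) →
          (∀ x : W.sha, (p : ℤ) • x = 0 → x = 0) → MissingUpperBoundAt W p) ∧
        (∀ (W : WeierstrassCurve ℚ) [W.IsElliptic] [W.IsGloballyMinimal] (p : ℕ) [Fact p.Prime],
          ClassX11a W p → ¬ Surj W p → 5 ≤ p → (∀ (ℓ : ℕ) [Fact ℓ.Prime], ¬ W.HasSplitMultiplicativeReductionAtPrime ℓ) →
          (∃ x : W.sha, (p : ℤ) • x = 0 ∧ x ≠ 0) → MissingUpperBoundAt W p) ∧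
        (∀ (W : WeierstrassCurve ℚ) [W.IsElliptic] [W.IsGloballyMinimal] (p : ℕ) [Fact p.Prime],
          ClassX11a W p → ¬ Surj W p → 5 ≤ p →
          (∃ (ℓ : ℕ) (_ : Fact ℓ.Prime), W.HasSplitMultiplicativeReductionAtPrime ℓ) → MissingUpperBoundAt W p)) :=
  ⟨fun h => ⟨noPTorsionSector_of_upperNonSurjFive h, pTorsionResidual_of_upperNonSurjFive h,
      splitMultResidual_of_upperNonSurjFive h⟩,
    fun h => upperNonSurjFive_of_noPTorsionSector_of_residuals h.1 h.2.1 h.2.2⟩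

/-- **The registered residuals imply the arithmetic residuals (modulo GZK).**  R₁ (off the main locus) ∧ R₂ (main locus, every datum
GL₁-obstructed) ⇒ R′ ∧ R₁′: a pair with a split multiplicative prime is off the main locus (`noSplitMult_of_mainLocus`), so R₁ covers
R₁′; a pair with `Ш(E)[p] ≠ 0` has every datum obstructed on the main locus (contrapositive of `noPTorsion_of_selmerTrivial_of_mainLocus`,
which needs GZK for `rank = 0`), so R₂ ∪ R₁ covers R′.  So the arithmetic split asks NO MORE of the future than the registered one.
[cite: MazurRubin2004, Def. 2.1.1] [cite: SilvermanAEC2009, Thm. X.4.2 (a)] -/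
theorem arithResiduals_of_residuals (hGZK : rank_eq_analyticRank_of_analyticRank_le_one)
    (hR₁ : ∀ (W : WeierstrassCurve ℚ) [W.IsElliptic] [W.IsGloballyMinimal] (p : ℕ) [Fact p.Prime],
      ClassX11a W p → ¬ Surj W p → 5 ≤ p → ¬ MainLocus W p → MissingUpperBoundAt W p)
    (hR₂ : ∀ (W : WeierstrassCurve ℚ) [W.IsElliptic] [W.IsGloballyMinimal] (p : ℕ) [Fact p.Prime],
      ClassX11a W p → ¬ Surj W p → 5 ≤ p → MainLocus W p → (∀ 𝒟 : CartanDatum W p, ¬ 𝒟.SelmerTrivial) →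
      MissingUpperBoundAt W p) :
    (∀ (W : WeierstrassCurve ℚ) [W.IsElliptic] [W.IsGloballyMinimal] (p : ℕ) [Fact p.Prime],
        ClassX11a W p → ¬ Surj W p → 5 ≤ p → (∀ (ℓ : ℕ) [Fact ℓ.Prime], ¬ W.HasSplitMultiplicativeReductionAtPrime ℓ) →
        (∃ x : W.sha, (p : ℤ) • x = 0 ∧ x ≠ 0) → MissingUpperBoundAt W p) ∧
      (∀ (W : WeierstrassCurve ℚ) [W.IsElliptic] [W.IsGloballyMinimal] (p : ℕ) [Fact p.Prime],
        ClassX11a W p → ¬ Surj W p → 5 ≤ p →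
        (∃ (ℓ : ℕ) (_ : Fact ℓ.Prime), W.HasSplitMultiplicativeReductionAtPrime ℓ) → MissingUpperBoundAt W p) := by
  refine ⟨fun W _ _ p _ hX hns hp5 _ hSha => ?_, fun W _ _ p _ hX hns hp5 hsm => ?_⟩
  · by_cases hL : MainLocus W p
    · refine hR₂ W p hX hns hp5 hL fun 𝒟 h𝒟 => ?_
      obtain ⟨x, hx, hx0⟩ := hSha
      exact hx0 (noPTorsion_of_selmerTrivial_of_mainLocus hGZK hX hp5 hL 𝒟 h𝒟 x hx)
    · exact hR₁ W p hX hns hp5 hL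
  · obtain ⟨ℓ, hℓ, hsplit⟩ := hsm
    exact hR₁ W p hX hns hp5 fun hL => noSplitMult_of_mainLocus hL ℓ hsplit

/-- **The arithmetic residuals imply the registered residuals (modulo the three prints).**  R′ ∧ R₁′ ⇒ R₁ ∧ R₂: both R₁ and R₂ are U5 on
sub-loci, and U5 follows from SECTOR′ (§1, conditional on GZK, modularity, Mazur) + R′ + R₁′.  Together with
`arithResiduals_of_residuals`: the two splits of item 20614 are EQUIVALENT modulo the three prints; the arithmetic one has datum-free
children and the larger proved sector. [cite: Mazur1978, Cor. 4.1] [cite: Wuthrich2014, Thm. 1 and Cor. 7] [cite: Miller2011LMS, Def. 1.1] -/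
theorem residuals_of_arithResiduals
    (hGZK : rank_eq_analyticRank_of_analyticRank_le_one)
    (hnf : Literature.NumberTheory.EllipticCurves.ModularForms.exists_isNewformOf)
    (hMz : Literature.NumberTheory.EllipticCurves.ModularForms.mazur_not_dvd_maninConstant_of_odd)
    (hR' : ∀ (W : WeierstrassCurve ℚ) [W.IsElliptic] [W.IsGloballyMinimal] (p : ℕ) [Fact p.Prime],
      ClassX11a W p → ¬ Surj W p → 5 ≤ p → (∀ (ℓ : ℕ) [Fact ℓ.Prime], ¬ W.HasSplitMultiplicativeReductionAtPrime ℓ) →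
      (∃ x : W.sha, (p : ℤ) • x = 0 ∧ x ≠ 0) → MissingUpperBoundAt W p)
    (hR₁' : ∀ (W : WeierstrassCurve ℚ) [W.IsElliptic] [W.IsGloballyMinimal] (p : ℕ) [Fact p.Prime],
      ClassX11a W p → ¬ Surj W p → 5 ≤ p →
      (∃ (ℓ : ℕ) (_ : Fact ℓ.Prime), W.HasSplitMultiplicativeReductionAtPrime ℓ) → MissingUpperBoundAt W p) :
    (∀ (W : WeierstrassCurve ℚ) [W.IsElliptic] [W.IsGloballyMinimal] (p : ℕ) [Fact p.Prime],
        ClassX11a W p → ¬ Surj W p → 5 ≤ p → ¬ MainLocus W p → MissingUpperBoundAt W p) ∧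
      (∀ (W : WeierstrassCurve ℚ) [W.IsElliptic] [W.IsGloballyMinimal] (p : ℕ) [Fact p.Prime],
        ClassX11a W p → ¬ Surj W p → 5 ≤ p → MainLocus W p → (∀ 𝒟 : CartanDatum W p, ¬ 𝒟.SelmerTrivial) →
        MissingUpperBoundAt W p) :=
  have hU : PrintX11a.UpperNonSurjFive := upperNonSurjFive_of_facts_of_arithResiduals hGZK hnf hMz hR' hR₁'
  ⟨fun W _ _ p _ hX hns hp5 _ => hU W p hX hns hp5, fun W _ _ p _ hX hns hp5 _ _ => hU W p hX hns hp5⟩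

end Summit.BirchSwinnertonDyer.BirchSwinnertonDyer.Theorems.GL1Cartan

end
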